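import Literature.Computability.Cryptography.TreeSigInstance
import Literature.Computability.Cryptography.PRGFromBitCommitment
import Literature.Computability.Cryptography.SchemesCommitment
import HarnessLib

/-!
# Bit commitment implies secure signature schemes (Impagliazzo–Luby 1989 with Rompel 1990): the discharge

Topic `Literature/Computability/Cryptography`. Discharge of the named fact
`secureSignaturesExist_of_bitCommitmentExist : BitCommitmentExist → SecureSignaturesExist` (`Schemes.lean`: the
corollary of Impagliazzo–Luby 1989, Thm. 1 — bit commitment ⇒ one-way functions — and Rompel 1990 / Goldreich 2004,
Thm. 6.4.1 — one-way functions ⇒ EUF-CMA signatures) from proved lines of the tree, WITHOUT the step "one-way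
functions ⇒ pseudorandom generators" (Håstad–Impagliazzo–Levin–Luby) on which the route through the fact
`secureSignaturesExist_of_OWFExist` still depends:

* bit commitment ⇒ one-way functions: `OWFExist_of_bitCommitmentExist_holds` (`SchemesCommitment.lean`,
  `CommitmentOneWay.lean`; Impagliazzo–Luby 1989, Thm. 1);
* bit commitment ⇒ pseudorandom generators DIRECTLY — the committed bit is one bit of false entropy of the samplable
  pair `(commit(b; r), b)` (Luby 1996, Lecture 10, Thm. 10.3) — hence pseudorandom functions (Goldreich–Goldwasser–Micali):
  `PRFExist_of_bitCommitmentExist` (`PRGFromBitCommitment.lean`);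
* one-way functions + pseudorandom functions ⇒ EUF-CMA signature schemes: universal one-way hashing from one-way
  functions (`HHRVW.exists_isUOWHF_of_OWFExist`, Goldreich 2004, Thm. 6.4.29), one-time hash-and-sign over Lamport's
  scheme (Constructions 6.4.30 / 6.4.4), and the memoryless authentication tree (Construction 6.4.16, Prop. 6.4.17,
  Thm. 6.4.9): `secureSignaturesExist_of_OWFExist_of_PRFExist` (`TreeSigInstance.lean`).

All proved; no named facts (this file discharges one).

## References

* R. Impagliazzo, M. Luby, *One-way functions are essential for complexity based cryptography*, FOCS 1989, Thm. 1.
* J. Rompel, *One-way functions are necessary and sufficient for secure signatures*, STOC 1990, Thm. 3.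
* O. Goldreich, *Foundations of Cryptography II: Basic Applications*, CUP 2004, Thm. 6.4.1, Thm. 6.4.9, Thm. 6.4.29,
  Thm. 6.4.32, §6.4.3.4 (the assembly of Thm. 6.4.1).
* M. Luby, *Pseudorandomness and Cryptographic Applications*, Princeton UP 1996, Lecture 10, Thm. 10.3.
* O. Goldreich, S. Goldwasser, S. Micali, *How to construct random functions*, J. ACM 33 (1986), Thm. 3.
-/

namespace Literature.Computability.Cryptography

/-- **Bit commitment ⇒ EUF-CMA-secure signature schemes** — the discharge of
`secureSignaturesExist_of_bitCommitmentExist`: one-way functions (Impagliazzo–Luby) and pseudorandom functions (false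
entropy ⇒ PRG ⇒ GGM) from the commitment scheme, then Goldreich's Thm. 6.4.1 assembly modulo the PRF
(`secureSignaturesExist_of_OWFExist_of_PRFExist`).
[cite: ImpagliazzoLuby1989, Thm. 1; Rompel1990, Thm. 3; Goldreich2004, Thm. 6.4.1 with Thm. 6.4.9] -/
theorem secureSignaturesExist_of_bitCommitmentExist_holds : secureSignaturesExist_of_bitCommitmentExist := fun h =>
  secureSignaturesExist_of_OWFExist_of_PRFExist (OWFExist_of_bitCommitmentExist_holds h) (PRFExist_of_bitCommitmentExist h)

end Literature.Computability.Cryptography
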